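import Summits.CriticalPhenomena.PercolationContinuityZ3.Theorems.Transplant.KNCells2RunO
import Summits.CriticalPhenomena.PercolationContinuityZ3.Theorems.Transplant.KNCells2Run
import Summits.CriticalPhenomena.PercolationContinuityZ3.Theorems.Transplant.KNCellsRunInvO
import Summits.CriticalPhenomena.PercolationContinuityZ3.Theorems.Transplant.KNCellsRunInv
import Summits.CriticalPhenomena.PercolationContinuityZ3.Theorems.Transplant.KNCellsSchemeO
import Summits.CriticalPhenomena.PercolationContinuityZ3.Theorems.Transplant.KNCellsProcessO
import Summits.CriticalPhenomena.PercolationContinuityZ3.Theorems.Transplant.KNCellsRunO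
import Summits.CriticalPhenomena.PercolationContinuityZ3.Theorems.Transplant.KNCells2SchemeO
import Summits.CriticalPhenomena.PercolationContinuityZ3.Theorems.Transplant.KNCells2RunInv
import Literature.Probability.Percolation.OrientedHistorySiteRenormalizationRun
import HarnessLib

/-!
# N2 (frames-only node `SamePDropOfSkeletonFrm₁`, OPEN) — ORIENTED MACRO LAYER (WAVE 0 (c1), (R-18) `q ≡ true`): the oriented twin of N1's `KNCells2RunInv`

builds on p205010 (kernel theorem, internal audit signed; external expert review pending) — nothing in this file uses p205010; NOTHING is claimed about the
open node `SamePDropOfSkeletonFrm₁` (`SamePDropOfSkeletonNeg₁` is CLOSED in the tree and untouched by this file).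
Status sentence (coordinator 2026-08-20T04:30Z): "θ(p_c) = 0 on ℤ^d, all d ≥ 2 — kernel-verified (Lean 4/Mathlib, standard axioms); internal adversarial
audit SIGNED 2026-08-20 04:29Z; external expert review pending."
Lane `prim-bschramm-*`, seat `prim-bschramm-stmt` (gen 19); helper file (`--supports stmt-CriticalPhenomena-4575 --as helper`); N2-SCOPE §20, (R-18)/(R-19).
PORT RULES (HOME/prim-bschramm-stmt-g19/lean/port_orient.py): the history-site API is replaced by its ORIENTED twin at the fixed quadrant `qNE := fun _ => true`
(`HState.choice ↦ HState.ochoice qNE`, `mstOf ↦ omstOf qNE`, `mst/stN ↦ omst/ostN qNE`, `occFinal ↦ ooccFinal qNE`, `Lawful ↦ OLawful qNE`, onward directions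
`onward ↦ onwardO` = the POSITIVE ones, (N2-e)); every declaration whose text changes thereby — directly or through a changed declaration — is re-declared with the
suffix `O` (same namespace); unchanged declarations of the N1 file are NOT repeated (the N1 module is imported). Docstrings/citations are N1's.
N1 HEADER (kept for the reader):
* `AnchGeom Γ` — the admissible-anchor sets contain their centre and do not depend on the macro-vertex (instance: fibre balls);
* `RunInv₂`, `V_step₂`, **`runInv₂`**.
[cite: KozmaNitzan2024, §4 pp. 26–27 ((29), E_{i+1}) — the ℤ^d model] [cite: GrimmettPercolation1999, §7.2]
-/
noncomputable section

open MeasureTheory ProbabilityTheory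
open scoped ENNReal Classical

namespace Summit.CriticalPhenomena.PercolationContinuityZ3.Theorems

namespace Transplant

namespace KNCells

open Literature.Probability.Percolation Literature.Probability.LatticeModels SimpleGraph GadgetSystem ProbeHistory HSiteScheme
open Literature.Probability.Percolation.KozmaNitzan (opens opens_nil opens_cons_none opens_cons_some)

variable {V : Type*} [DecidableEq V]

namespace KSchA

variable {A : Type*} {G : SimpleGraph V} [G.LocallyFinite] (S : KSchA V A)

variable (G) in
/-- **The invariant of the run of `scheme₂O` after `n` steps.** [cite: KozmaNitzan2024, §4 pp. 26–27 ((29), E_{i+1})] -/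
structure RunInv₂O (ω : BondConfig V) (n : ℕ) : Prop where
  F_eq : S.F G (S.hst₂O G ω n) = edgesIn G (S.Vx G (S.hst₂O G ω n))
  ξ_iff : ∀ x, x ∈ S.ξ G (S.hst₂O G ω n) ↔ x ∈ S.F G (S.hst₂O G ω n) ∧ (x ∈ ω ∨ x ∈ S.U₀ G)
  V_cases : ∀ y ∈ S.Vx G (S.hst₂O G ω n), y ∈ S.Γ.Q S.Γ.a₀ 0 ∨ ∃ m < n, ∃ e, ((S.scheme₂O G).ostN qNE m ω).ochoice qNE = some e ∧
    S.Valid₂O G (S.hst₂O G ω m) e ∧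
    (S.scheme₂O G).E.next (S.hst₂O G ω m) = some (S.probe₂O G (S.hst₂O G ω m) e (S.aOf₁O G (S.hst₂O G ω m) e) (S.aOf₂O G (S.hst₂O G ω m) e)) ∧
    y ∈ S.newR₂O G ω (S.hst₂O G ω m) e
  det_Q : ∀ x, ((S.scheme₂O G).ostN qNE n ω).Det x → ∃ a, S.Γ.Q a x ⊆ S.Vx G (S.hst₂O G ω n)
  Q0_sub : S.Γ.Q S.Γ.a₀ 0 ⊆ S.Vx G (S.hst₂O G ω n)
  arr_zero : (S.astOf₂O G (S.hst₂O G ω n)).arr 0 = S.Γ.a₀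
  anch : ∀ x v', (S.astOf₂O G (S.hst₂O G ω n)).dep x ∈ S.Γ.anchSet ((S.astOf₂O G (S.hst₂O G ω n)).arr x) v'

variable {S}

/-- The step of the explored region at a probe: `E_{i+1} = E_i ∪ E^α_{v,x} ∪ ⋃_y H^{j_y,β}_{x,y}`. [cite: KozmaNitzan2024, §4 p. 27 (E_{i+1})] -/
theorem V_step₂O (hΓ : RunGeom G S.Γ) {ω : BondConfig V} {n : ℕ} (hI : S.RunInv₂O G ω n) {e : Site 2 × MDir}
    (hc : ((S.scheme₂O G).ostN qNE n ω).ochoice qNE = some e)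
    (hD : (S.scheme₂O G).E.next (S.hst₂O G ω n) = some (S.probe₂O G (S.hst₂O G ω n) e (S.aOf₁O G (S.hst₂O G ω n) e) (S.aOf₂O G (S.hst₂O G ω n) e))) :
    S.F G (S.hst₂O G ω (n + 1)) = edgesIn G (S.Vx G (S.hst₂O G ω n) ∪ S.newR₂O G ω (S.hst₂O G ω n) e) ∧
      S.Vx G (S.hst₂O G ω (n + 1)) = S.Vx G (S.hst₂O G ω n) ∪ S.newR₂O G ω (S.hst₂O G ω n) e := by
  obtain ⟨hF, -, -⟩ := S.step_some₂O hc hD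
  have hF' : S.F G (S.hst₂O G ω (n + 1)) = edgesIn G (S.Vx G (S.hst₂O G ω n) ∪ S.newR₂O G ω (S.hst₂O G ω n) e) := by
    rw [hF, revealOf₂O, Finset.union_sdiff_self_eq_union]
    refine Finset.union_eq_right.2 ?_
    rw [hI.F_eq]
    intro x hx
    rw [mem_edgesIn_iff] at hx ⊢
    exact ⟨hx.1, fun y hy => Finset.mem_union_left _ (hx.2 y hy)⟩
  refine ⟨hF', ?_⟩
  show vspan (S.F G (S.hst₂O G ω (n + 1))) = _
  rw [hF']
  refine vspan_edgesIn_eq fun y hy => ?_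
  rcases Finset.mem_union.1 hy with hy | hy
  · have hy' : y ∈ vspan (edgesIn G (S.Vx G (S.hst₂O G ω n))) := by
      rw [← hI.F_eq]; exact hy
    obtain ⟨z, hz, hadj⟩ := exists_adj_of_mem_vspan_edgesIn hy'
    exact ⟨z, Finset.mem_union_left _ hz, hadj⟩
  · obtain ⟨z, hz, hadj⟩ := S.exists_adj_of_mem_newRegionO hΓ _ _ _ _ _ hy
    exact ⟨z, Finset.mem_union_right _ hz, hadj⟩

/-- **The invariant holds along the run.** [cite: KozmaNitzan2024, §4 pp. 26–27] -/
theorem runInv₂O (hΓ : RunGeom G S.Γ) (hA : AnchGeom S.Γ) (ω : BondConfig V) : ∀ n, S.RunInv₂O G ω n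
  | 0 => by
    have hV : S.Vx G (S.hst₂O G ω 0) = S.Γ.Q S.Γ.a₀ 0 := S.V_nil hΓ
    have hF : S.F G (S.hst₂O G ω 0) = S.U₀ G := by
      show S.F G [] = S.U₀ G
      unfold F; rw [supp_nil, Finset.union_empty]
    refine ⟨?_, ?_, ?_, ?_, ?_, rfl, ?_⟩
    · rw [hV, hF]; rfl
    · intro x
      have hξ : S.ξ G (S.hst₂O G ω 0) = S.U₀ G := by
        show S.ξ G [] = S.U₀ G
        unfold ξ; rw [opens_nil, Finset.union_empty]
      rw [hξ, hF]; tauto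
    · intro y hy; rw [hV] at hy; exact Or.inl hy
    · intro x hx
      have hx' : x = 0 := by
        rcases hx with hx | hx
        · simpa [HSiteScheme.ostN, HSiteScheme.omst, HState.start] using hx
        · simp [HSiteScheme.ostN, HSiteScheme.omst, HState.start] at hx
      subst hx'
      exact ⟨S.Γ.a₀, by rw [hV]⟩
    · rw [hV]
    · intro x v'
      show S.Γ.a₀ ∈ S.Γ.anchSet S.Γ.a₀ v'
      exact hA.refl _ _
  | n + 1 => by
    have hI := runInv₂O hΓ hA ω n
    rcases S.next_cases₂O (G := G) ω n with hD | ⟨e, hc, hV, hD⟩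
    · obtain ⟨hF, hξ, hstO, hast⟩ := S.step_none₂O hD
      have hVV : S.Vx G (S.hst₂O G ω (n + 1)) = S.Vx G (S.hst₂O G ω n) := by
        show vspan _ = vspan _; rw [hF]
      refine ⟨?_, ?_, ?_, ?_, ?_, ?_, ?_⟩
      · rw [hF, hVV]; exact hI.F_eq
      · intro x; rw [hξ, hF]; exact hI.ξ_iff x
      · intro y hy
        rw [hVV] at hy
        rcases hI.V_cases y hy with h | ⟨m, hm, rest⟩
        · exact Or.inl h
        · exact Or.inr ⟨m, by omega, rest⟩
      · intro x hx
        rw [hstO] at hx; rw [hVV]; exact hI.det_Q x hx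
      · rw [hVV]; exact hI.Q0_sub
      · rw [hast]; exact hI.arr_zero
      · intro x v'; rw [hast]; exact hI.anch x v'
    · obtain ⟨hF1, hξ1, hstO, harr, hdep⟩ := S.step_some₂O hc hD
      obtain ⟨hF2, hV2⟩ := V_step₂O hΓ hI hc hD
      have h0ne : (0 : Site 2) ≠ tgt e := fun h0 =>
        (HState.cand_of_ochoice hc).2 (h0 ▸ Or.inl ((S.scheme₂O G).inv_omst qNE _).zero_mem)
      refine ⟨?_, ?_, ?_, ?_, ?_, ?_, ?_⟩
      · rw [hF2, hV2]
      · intro x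
        rw [hξ1, hF1, Finset.mem_union, Finset.mem_union, mem_obs_iff, hI.ξ_iff x]
        constructor
        · rintro (⟨hxF, h'⟩ | ⟨hxr, hxω⟩)
          · exact ⟨Or.inl hxF, h'⟩
          · exact ⟨Or.inr hxr, Or.inl hxω⟩
        · rintro ⟨hxF | hxr, h'⟩
          · exact Or.inl ⟨hxF, h'⟩
          · by_cases hxF : x ∈ S.F G (S.hst₂O G ω n)
            · exact Or.inl ⟨hxF, h'⟩
            · rcases h' with h' | h'
              · exact Or.inr ⟨hxr, h'⟩
              · exact absurd (S.U₀_subset_F _ h') hxF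
      · intro y hy
        rw [hV2] at hy
        rcases Finset.mem_union.1 hy with hy | hy
        · rcases hI.V_cases y hy with h | ⟨m, hm, rest⟩
          · exact Or.inl h
          · exact Or.inr ⟨m, by omega, rest⟩
        · exact Or.inr ⟨n, Nat.lt_succ_self n, e, hc, hV, hD, hy⟩
      · intro x hx
        rw [hstO] at hx
        rw [hV2]
        rcases (HState.det_update_iff _ _ _).1 hx with rfl | hx
        · refine ⟨S.aOf₁O G (S.hst₂O G ω n) e, fun y hy => ?_⟩
          exact Finset.mem_union_right _ (Finset.mem_union_left _ (Finset.mem_union_right _ hy))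
        · obtain ⟨a, ha⟩ := hI.det_Q x hx
          exact ⟨a, ha.trans Finset.subset_union_left⟩
      · rw [hV2]; exact hI.Q0_sub.trans Finset.subset_union_left
      · rw [harr, Function.update_of_ne h0ne]; exact hI.arr_zero
      · intro x v'
        rw [harr, hdep]
        by_cases hx : x = tgt e
        · subst hx
          rw [Function.update_self, Function.update_self]
          -- the stored entry anchor is admissible for the new region anchor `dep e.1 = arr (tgt e)`
          rw [hA.const _ v' (tgt e)]
          exact S.Γ.anchor_mem _ _ _
        · rw [Function.update_of_ne hx, Function.update_of_ne hx]; exact hI.anch x v'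

end KSchA

end KNCells

end Transplant

end Summit.CriticalPhenomena.PercolationContinuityZ3.Theorems

end
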